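import Literature.Geometry.Lorentzian.KerrRadiusGradientVector
import Literature.Geometry.Lorentzian.KerrSchildTimeTranslation
import Summits.FinalStateConjecture.FinalStateConjecture.Theorems.BartnikGapSettlingGapExhaustionCylindersExactMargin
import Summits.FinalStateConjecture.FinalStateConjecture.Theorems.BartnikGapSettlingGapExhaustionCylindersBendInwardOf
import HarnessLib

/-!
# Crux `GapExhaustion` (stmt-FinalStateConjecture-10808), line `photon-shell-pseudoconvexity`:
# stub (P-3) `stub_kerrRadiusNoncharacteristic` — `r` is uniformly non-characteristic on Kerr bands

Route `BartnikGapSettling`; helper (`--supports stmt-FinalStateConjecture-10808`) landing the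
registered sub-stub (P-3) of the quantitative `T`-conditional pseudo-convexity bricks
(Ionescu–Klainerman, Invent. Math. 175 (2009), Definition 3.1, the non-characteristic datum of
condition (po3.2) `D^αh D^βh (D_αh D_βh − ε D_αD_βh) ≥ ε₁²` for `h = r`): **in exact Kerr,
Kerr–Schild Cartesian coordinates, on every radial band `r₊ < r_lo ≤ r ≤ r_e` (all Kerr-star
times, axis included) the metric gradient `Y = ♯dr = g_{M,a}⁻¹ dr` of the Kerr–Schild radius
satisfies `dr(Y) = g⁻¹(dr, dr) ≥ ν > 0` and `|Hess r(Y, Y)| ≤ B`.**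

Pointwise, `♯dr` is the explicit vector `Kerr.radiusGradVector` (`Kerr.bilin_radiusGradVector`,
`MetricCoord.sharpAt_eq_of_forall`), so `dr(♯dr) = g(♯dr, ♯dr) = Δ(r)/Σ`
(`Kerr.bilin_radiusGradVector_self`) with `Δ(r) = (r − r₊)(r − r₋) > 0` beyond the event horizon
and `Σ > 0`. Uniformity: both `z ↦ dr_z(♯dr_z)` and `z ↦ Hess r_z(♯dr_z, ♯dr_z)` are continuous
on `{r > 0}` (`IsMetricOn.contDiffOn_sharpAt`, `kerrCylindersExactMargin_continuousOn_hessAt`),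
hence attain a positive minimum, respectively a bound, on the compact time slice
`{z⁰ = 0, r_lo ≤ r ≤ r_e}` (`kerrCylindersBendInward_isCompact_slice`); stationarity of Kerr
(`Kerr.bilin_add_time`, `Kerr.radius_add_time_smul_basisVector`, `fderiv_radius_add_time`,
`kerrCylindersExactMargin_hessAt_add_time`) transports both bounds to all times.
-/

noncomputable section

-- instance search through the nested operator types `E4 →L[ℝ] E4 →L[ℝ] E4 →L[ℝ] ℝ`
set_option maxSynthPendingDepth 3

-- D-0017: single-problem summit, `Summit.<S>.<S>.…` by design (cf. lakefile `weak.linter.dupNamespace`).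
set_option linter.dupNamespace false

namespace Summit.FinalStateConjecture.FinalStateConjecture.Theorems

open Set Literature.Geometry.Lorentzian Literature.Geometry.Lorentzian.MetricCoord
open scoped Manifold ContDiff Topology ENNReal

/-- The metric gradient `♯dr = g_{M,a}⁻¹ dr` of the Kerr–Schild radius is the explicit vector
`Kerr.radiusGradVector M a` wherever `r > 0`. -/
private theorem radiusNonchar_sharpAt_eq {M a : ℝ} {z : E4} (hz : 0 < Kerr.radius a z) :
    sharpAt (Kerr.bilin M a) z (fderiv ℝ (Kerr.radius a) z) = Kerr.radiusGradVector M a z := by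
  have hinv : (Kerr.bilin M a z).IsInvertible :=
    isInvertible_of_nondegenerate fun v hv ↦ Kerr.bilin_nondegenerate M a hz v hv
  refine sharpAt_eq_of_forall hinv fun w ↦ ?_
  rw [(Kerr.hasFDerivAt_radius_bilin (M := M) hz).fderiv]

/-- `dr(♯dr) = g⁻¹(dr, dr) = Δ(r)/Σ` wherever `r > 0` (the Boyer–Lindquist `g^{rr}`). -/
private theorem radiusNonchar_fderiv_sharpAt {M a : ℝ} {z : E4} (hz : 0 < Kerr.radius a z) :
    fderiv ℝ (Kerr.radius a) z (sharpAt (Kerr.bilin M a) z (fderiv ℝ (Kerr.radius a) z)) =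
      (Kerr.radius a z ^ 2 - 2 * M * Kerr.radius a z + a ^ 2) / Kerr.blSigma a (E4.spatial z) := by
  rw [radiusNonchar_sharpAt_eq hz, (Kerr.hasFDerivAt_radius_bilin (M := M) hz).fderiv,
    Kerr.bilin_radiusGradVector_self hz]

/-- Beyond the event horizon of a subextremal Kerr, `dr(♯dr) = Δ(r)/Σ > 0`. -/
private theorem radiusNonchar_fderiv_sharpAt_pos {M a : ℝ} (ha : |a| < M) {z : E4}
    (hz : Kerr.rPlus M a < Kerr.radius a z) :
    0 < fderiv ℝ (Kerr.radius a) z (sharpAt (Kerr.bilin M a) z (fderiv ℝ (Kerr.radius a) z)) := by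
  have hsub : Kerr.IsSubextremal M a := ha
  have hz0 : 0 < Kerr.radius a z := hsub.rPlus_pos.trans hz
  rw [radiusNonchar_fderiv_sharpAt hz0]
  refine div_pos ?_ (Kerr.blSigma_spatial_pos hz0)
  rw [← Kerr.sub_rPlus_mul_sub_rMinus hsub.sq_lt_sq.le]
  exact Kerr.sub_rPlus_mul_sub_rMinus_pos hz

/-- `z ↦ ♯dr_z` is continuous on the Kerr chart domain. -/
private theorem radiusNonchar_continuousOn_sharpAt_fderiv (M a r₀ : ℝ) :
    ContinuousOn (fun z : E4 ↦ sharpAt (Kerr.bilin M a) z (fderiv ℝ (Kerr.radius a) z))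
      (Kerr.region a r₀) := by
  have hG := KerrSchildChart.isMetricOn_kerrBilin M a r₀
  have h1 : ContinuousOn (fderiv ℝ (Kerr.radius a)) (Kerr.region a r₀) :=
    (Kerr.contDiffOn_radius_region a r₀).continuousOn_fderiv_of_isOpen (Kerr.region a r₀).isOpen
      (by exact_mod_cast le_top)
  exact hG.contDiffOn_sharpAt.continuousOn.clm_apply h1

/-- `z ↦ dr_z(♯dr_z)` is continuous on the Kerr chart domain. -/
private theorem radiusNonchar_continuousOn_fderiv_sharpAt (M a r₀ : ℝ) :
    ContinuousOn (fun z : E4 ↦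
      fderiv ℝ (Kerr.radius a) z (sharpAt (Kerr.bilin M a) z (fderiv ℝ (Kerr.radius a) z)))
      (Kerr.region a r₀) := by
  have h1 : ContinuousOn (fderiv ℝ (Kerr.radius a)) (Kerr.region a r₀) :=
    (Kerr.contDiffOn_radius_region a r₀).continuousOn_fderiv_of_isOpen (Kerr.region a r₀).isOpen
      (by exact_mod_cast le_top)
  exact h1.clm_apply (radiusNonchar_continuousOn_sharpAt_fderiv M a r₀)

/-- `z ↦ Hess r_z(♯dr_z, ♯dr_z)` is continuous on the Kerr chart domain. -/
private theorem radiusNonchar_continuousOn_hessAt_sharpAt (M a r₀ : ℝ) :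
    ContinuousOn (fun z : E4 ↦
      hessAt (Kerr.bilin M a) (Kerr.radius a) z
        (sharpAt (Kerr.bilin M a) z (fderiv ℝ (Kerr.radius a) z))
        (sharpAt (Kerr.bilin M a) z (fderiv ℝ (Kerr.radius a) z))) (Kerr.region a r₀) :=
  ((kerrCylindersExactMargin_continuousOn_hessAt M a r₀).clm_apply
    (radiusNonchar_continuousOn_sharpAt_fderiv M a r₀)).clm_apply
    (radiusNonchar_continuousOn_sharpAt_fderiv M a r₀)

/-- `♯dr` is invariant under Kerr-star time translations (Kerr is stationary). -/
private theorem radiusNonchar_sharpAt_fderiv_add_time (M a : ℝ) (z : E4) (t : ℝ) :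
    sharpAt (Kerr.bilin M a) (z + t • E4.basisVector 0)
        (fderiv ℝ (Kerr.radius a) (z + t • E4.basisVector 0)) =
      sharpAt (Kerr.bilin M a) z (fderiv ℝ (Kerr.radius a) z) := by
  unfold sharpAt
  rw [Kerr.bilin_add_time M a t z,
    SwallowTheDatum.KerrShieldedSettles.KerrExteriorFlatDecay.fderiv_radius_add_time a z t]

/-- **Stub (P-3) of the quantitative `T`-conditional pseudo-convexity bricks (crux `GapExhaustion`,
stmt-FinalStateConjecture-10808; line photon-shell-pseudoconvexity) — the Kerr–Schild radius is
uniformly non-characteristic on Kerr bands.** For `0 < M`, `|a| < M` and a band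
`r₊ < r_lo < r_e` there are `ν > 0` and `B` such that at every point `z` of Kerr–Schild coordinate
space with `r_lo ≤ r(z) ≤ r_e` (all times, axis included) the metric gradient
`Y = ♯dr_z = g_{M,a}(z)⁻¹ dr_z` satisfies `dr_z(Y) ≥ ν` and `|Hess r_z(Y, Y)| ≤ B`
(Ionescu–Klainerman, Invent. Math. 175 (2009), Def. 3.1, the data of (po3.2) for `h = r`).
Pointwise `dr(♯dr) = Δ(r)/Σ > 0`; uniformity by compactness of the slice `{z⁰ = 0}` of the band and
stationarity. -/
theorem stub_kerrRadiusNoncharacteristic :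
    ∀ (M a r_lo r_e : ℝ), 0 < M → |a| < M → Kerr.rPlus M a < r_lo → r_lo < r_e →
      ∃ (ν B : ℝ), 0 < ν ∧ ∀ z : E4, r_lo ≤ Kerr.radius a z → Kerr.radius a z ≤ r_e →
        ν ≤ fderiv ℝ (Kerr.radius a) z
            (sharpAt (Kerr.bilin M a) z (fderiv ℝ (Kerr.radius a) z)) ∧
        |hessAt (Kerr.bilin M a) (Kerr.radius a) z
            (sharpAt (Kerr.bilin M a) z (fderiv ℝ (Kerr.radius a) z))
            (sharpAt (Kerr.bilin M a) z (fderiv ℝ (Kerr.radius a) z))| ≤ B := by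
  intro M a r_lo r_e _hM ha hlo _hloe
  have hsub : Kerr.IsSubextremal M a := ha
  have hlo0 : 0 < r_lo := hsub.rPlus_pos.trans hlo
  -- the compact time slice of the band, inside the chart domain `{r > 0}`
  set S : Set E4 := {z : E4 | z 0 = 0 ∧ r_lo ≤ Kerr.radius a z ∧ Kerr.radius a z ≤ r_e} with hS
  have hSc : IsCompact S := kerrCylindersBendInward_isCompact_slice a r_e hlo0
  have hSreg : S ⊆ (Kerr.region a 0 : Set E4) := fun z hz ↦ by
    have : max 0 0 < Kerr.radius a z := by rw [max_self]; exact hlo0.trans_le hz.2.1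
    exact this
  -- the two continuous functions
  set F₁ : E4 → ℝ := fun z ↦
    fderiv ℝ (Kerr.radius a) z (sharpAt (Kerr.bilin M a) z (fderiv ℝ (Kerr.radius a) z)) with hF₁
  set F₂ : E4 → ℝ := fun z ↦ hessAt (Kerr.bilin M a) (Kerr.radius a) z
    (sharpAt (Kerr.bilin M a) z (fderiv ℝ (Kerr.radius a) z))
    (sharpAt (Kerr.bilin M a) z (fderiv ℝ (Kerr.radius a) z)) with hF₂
  have hF₁c : ContinuousOn F₁ S := (radiusNonchar_continuousOn_fderiv_sharpAt M a 0).mono hSreg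
  have hF₂c : ContinuousOn F₂ S := (radiusNonchar_continuousOn_hessAt_sharpAt M a 0).mono hSreg
  have hF₁pos : ∀ z ∈ S, 0 < F₁ z := fun z hz ↦
    radiusNonchar_fderiv_sharpAt_pos ha (hlo.trans_le hz.2.1)
  -- the positive minimum of `F₁` on the slice
  obtain ⟨ν, hν, hνS⟩ : ∃ ν : ℝ, 0 < ν ∧ ∀ z ∈ S, ν ≤ F₁ z := by
    by_cases hne : S.Nonempty
    · obtain ⟨z₀, hz₀, hmin⟩ := hSc.exists_isMinOn hne hF₁c
      exact ⟨F₁ z₀, hF₁pos z₀ hz₀, fun z hz ↦ hmin hz⟩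
    · exact ⟨1, one_pos, fun z hz ↦ absurd ⟨z, hz⟩ hne⟩
  -- a bound for `|F₂|` on the slice
  obtain ⟨B, hBS⟩ : ∃ B : ℝ, ∀ z ∈ S, ‖F₂ z‖ ≤ B := hSc.exists_bound_of_continuousOn hF₂c
  refine ⟨ν, B, hν, fun z hz₁ hz₂ ↦ ?_⟩
  -- translate `z` to the slice
  set t : ℝ := z 0 with ht
  set z' : E4 := z + (-t) • E4.basisVector 0 with hz'
  clear_value t
  have hrad : Kerr.radius a z' = Kerr.radius a z := Kerr.radius_add_time_smul_basisVector a z (-t)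
  have hsharp : sharpAt (Kerr.bilin M a) z' (fderiv ℝ (Kerr.radius a) z') =
      sharpAt (Kerr.bilin M a) z (fderiv ℝ (Kerr.radius a) z) :=
    radiusNonchar_sharpAt_fderiv_add_time M a z (-t)
  have hfd : fderiv ℝ (Kerr.radius a) z' = fderiv ℝ (Kerr.radius a) z :=
    SwallowTheDatum.KerrShieldedSettles.KerrExteriorFlatDecay.fderiv_radius_add_time a z (-t)
  have hhess : hessAt (Kerr.bilin M a) (Kerr.radius a) z' =
      hessAt (Kerr.bilin M a) (Kerr.radius a) z :=
    kerrCylindersExactMargin_hessAt_add_time M a z (-t)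
  have hz'0 : z' 0 = 0 := by
    simp [hz', ht, E4.basisVector]
  clear_value z'
  have hmem : z' ∈ S := ⟨hz'0, hrad ▸ hz₁, hrad ▸ hz₂⟩
  have h1 : F₁ z' = F₁ z := by
    simp only [hF₁]
    rw [hsharp, hfd]
  have h2 : F₂ z' = F₂ z := by
    simp only [hF₂]
    rw [hsharp, hhess]
  constructor
  · have := hνS z' hmem
    rwa [h1] at this
  · have := hBS z' hmem
    rwa [h2, Real.norm_eq_abs] at this

end Summit.FinalStateConjecture.FinalStateConjecture.Theorems

end
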